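import Literature.MathematicalPhysics.QuantumFieldTheory.Balaban1983to89.B12Ineq417Flat
import Literature.MathematicalPhysics.QuantumFieldTheory.Balaban1983to89.B12CauchyRemainder354

/-!
# `Balaban1983to89.B12Ineq418Flat` — [Balaban1987RG1] (4.18) p. 285 AT THE FLAT BACKGROUND: the second-difference bound
`|(∂_λ∂_νB_μ)(x)| < α₁(L^jη)^{2+β}` for the localized field `B_μ(x) = ζ̃_□(x)Q_{j,μ}(ηA, x)` built on the concrete composite
averaging `Q_j(1, ·)` of [Balaban1985Averaging] on `ℤ^d` — «by similar considerations as in the proof of (4.17)», the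
second-order input on `Q_j(1, ·)` being supplied by ITERATED ONE-VARIABLE CAUCHY ESTIMATES for the analytic `Q_j(1, ·)`
(Prop. 4 of [7]) — PROVED

HONEST FRAMING (cell `lit-balaban`, verbatim): statement-level skeleton of published theorems with citation tags; proofs
where landed; nothing here is a claim about the Yang–Mills mass gap.

CITATION HEADER.  T. Bałaban, *Renormalization group approach to lattice gauge field theories. I*, Commun. Math. Phys. **109**
(1987) 249–301 [Balaban1987RG1] (cell paper B12; journal page = PDF page + 248; held `paper:balaban1987-cmp109-rg-i-small-field`),
p. 285 [PDF 37], render `b2b-balaban-ref1/pages/1987-cmp109-rg-I-small-field/…-p037-x2.png`; T. Bałaban, *Averaging operations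
for lattice gauge theories*, Commun. Math. Phys. **98** (1985) 17–51 [Balaban1985Averaging] (cell paper B7), Prop. 4 p. 38, Prop. 5
(156) p. 42.  Unit `lit-balaban-r20` gen 4 (fold owner of B12; SKELETON row `B12.Eq4.16-4.18`, owner cell r09 — (4.18) was «NOT
TYPED» in p07's `B12Eq416DerivB` and absent in every reader cell; this file continues the same unit's `B12Ineq417Flat`, p246801).

THE PRINT (verbatim, p. 285, after (4.17)): «Thus the differentiation increases the power of L^jη by 1, and improves an overall
bound of an expression. For second order derivatives we have a weaker conclusion, because we do not have bounds for second
order derivatives of the field A, only for Hölder norms of first order derivatives in (3.32). They imply the bound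
|(∂_λ∂_νB_μ)(x)| < α₁(L^jη)^{2+β}, 0 ≦ β ≦ β₀ < 1, (4.18) by similar considerations as in the proof of (4.17). The
inequalities (4.17), (4.18) hold for the field δB also.»

DICTIONARY (continuing `B12Ineq417Flat`; b07's `B`-variables at `U₀ = 1`, fine lattice `ℤ^d` with unit steps, unit lattice
`T₁^{(j)} = L^jℤ^d`, `Q_{j,μ}(ηA, x) = B7Prop4Flat.logIter L B j z μ`, coarse step `e_ν` = `L^j` fine steps, translations
`shiftCfg`).  `(∂_λ∂_νB_μ)(x)` = the second unit-lattice difference `ddlocB` of `locB = ζ̃·Q_j(1, B)`.  SIZES (all `≥ 0`):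
`b ≥ sup ‖B‖`; `g ≥` the fine-step differences of `B` in the directions `λ`, `ν`; `g₂ ≥ ‖∇_νB(y + L^je_λ) − ∇_νB(y)‖`
(`∇_νB(y) = B(y + e_ν) − B(y)`), the COARSE variation of the fine gradient — this is where (3.32)'s Hölder norm enters: for
`B = ηA`, `∇_νB = η·η(∇^ηA)` and `|∇^ηA(y′) − ∇^ηA(y)| ≤ ‖A‖_{1,β}|y′ − y|^β` with `|y′ − y| = L^jη` (k-th scale units), so
`g₂ = η²‖A‖_{1,β}(L^jη)^β`; `δ₁ ≥` the coarse first differences of `ζ̃_□` (= `O(1)L^jη`), `δ₂ ≥` its coarse mixed second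
difference (= `O(1)(L^jη)²`).  With `b = 2η(…)`, `g = 2η²(…)`, the right side of `ineq418_flat` is
`O(1)[‖A‖_{1,β}(L^jη)^{2+β} + (L^jη)³ + (L^jη)⁴]`, i.e. the printed `α₁(L^jη)^{2+β}`-shape (`L^jη ≤ 1`, `β ≤ 1`);
`ineq418_flat_scaled` displays this law.

THE MECHANISM («similar considerations»).  With `a_λ = L^je_λ`, `a_ν = L^je_ν` and translation covariance
(`B12Ineq417Flat.logIter_shiftCfg`), the four values `Q(z)`, `Q(z+e_λ)`, `Q(z+e_ν)`, `Q(z+e_λ+e_ν)` are the values of ONE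
analytic function `f = Q_j(1, ·)(c)` on the finite product `𝔸^S` (`S` = bonds of the box of `c = ⟨x, x+e_μ⟩`) at `p = B|S`,
`p + V`, `p + W`, `p + V + W + Z` (`V = (t_{a_λ}B − B)|S`, `W = (t_{a_ν}B − B)|S`, `Z` = the restriction of the DOUBLE difference
`t_{a_λ+a_ν}B − t_{a_λ}B − t_{a_ν}B + B`, of size `≤ L^jg₂`).  Then
`Δ_λΔ_νQ = [f(p+V+W+Z) − f(p+V+W)] + [f(p+V+W) − f(p+V) − f(p+W) + f(p)]`; the first bracket is `≤ ‖Df‖·‖Z‖` (Prop. 5 [7] in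
operator form, `B7Prop5FlatOperator.opNorm_fderiv_real_avgMap_le`, mean value inequality), the second is the mixed second
difference of the analytic `(s, t) ↦ f(p + sV + tW)`, bounded by `M‖V‖‖W‖/r²` through two one-variable Cauchy estimates
(`B12CauchyRemainder354.norm_iteratedDeriv_le_of_ball`) and two real mean-value steps, `M = 2L^jb₁` the size of `Q_j(1, ·)`
on the polydisc of radius `b₁` ((131) of [7]) and `r` the margin `b + 2L^jg + 2r ≤ b₁`.

WHAT THIS FILE PROVES (kernel, 0 sorry, standard axioms; object definition `ddlocB`, no `def … : Prop`):
* §1 (pure complex analysis, any complex Banach spaces) `norm_sub_le_of_ball` (`‖g(1) − g(0)‖ ≤ M/(R − 1)` for `g` holomorphic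
  and bounded by `M` on `ball 0 R`, `R > 1`) and **`norm_secondDiff_le`**: `‖f(p+V+W) − f(p+V) − f(p+W) + f(p)‖ ≤ M‖V‖‖W‖/r²`.
* §2 the second differences on `ℤ^d`: `ddlocB` (`∂_λ∂_νB_μ`), the product rule `eq418_split`
  (`= ζ̃·Δ_λΔ_νQ + Δ_λζ̃·Δ_νQ(·+e_λ) + Δ_νζ̃·Δ_λQ(·+e_ν) + Δ_λΔ_νζ̃·Q(·+e_λ+e_ν)`), the double difference `dd2Cfg` of the fine field
  and its size `norm_dd2Cfg_le` (`≤ L^jg₂`), and the four-point decomposition `secondDiff_logIter_eq`.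
* §3 **(4.18) AT THE FLAT BACKGROUND** `ineq418_flat`: ‖∂_λ∂_νB_μ(z)‖ ≤ |ζ̃(z)|·(2dL^j(1 + C₃L^jb₁)·L^jg₂ + 2L^jb₁(L^jg)²/r²)
  + (δ_λ + δ_ν)·2dL^j(1 + C₃L^jb)·L^jg + δ₂·2L^jb, under `L ≥ 2`, `C₃(d,L)L^jb₁ ≤ 1`, `b + 2L^jg + 2r ≤ b₁`, `0 < r`; and
  `ineq418_flat_scaled`: for `B = ηA` with `sup |A| ≤ a`, `η`-differences `≤ ηa′`, coarse variation of the fine gradient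
  `≤ η·ηa″θ` (`θ` standing for `(L^jη)^β`, `L^jη ≤ θ ≤ 1`), `|ζ̃| ≤ 1`, `δ₁ ≤ c₁L^jη`, `δ₂ ≤ c₂(L^jη)²`, and the smallness
  `C₃L^jη(2a + 4L^jηa′) ≤ 1` (radius `b₁ = 1/(C₃L^j)`, margin `r = b₁/4`):
  `‖∂_λ∂_νB_μ(z)‖ ≤ (4da″ + 32C₃a′² + 8dc₁a′ + 2c₂a)·(L^jη)²·θ` — the printed `α₁(L^jη)^{2+β}` shape with an explicit constant;
  `ineq418_flat_rpow`: the same with `θ = (L^jη)^β`, `0 ≤ β ≤ 1`.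

DIVERGENCES / NOT PROVED.  Flat background only (`U₀ = 1`), `ℤ^d`, as `B12Ineq417Flat`; the second-order information on
`Q_j(1, ·)` is obtained HERE from analyticity (Prop. 4 [7]) by Cauchy estimates — the print does not say which second-order
property of the averaging it uses («similar considerations»), so the constant `32C₃a′²` is ours, not the paper's; the Hölder
input is carried as the size `g₂` (resp. `a″θ`) — its derivation from `‖A‖_{1,β}` of (3.32) (`B12Ineq332.ineq332_holder`,
`LatticeNorms.holderSeminormB5`) is the DICTIONARY above and is not re-derived; «hold for the field δB also» NOT proved; the
strict `<` of print is `≤` here; `β₀ < 1` plays no role in the inequality itself.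
-/

noncomputable section

open scoped BigOperators
open Set Metric MeasureTheory
open Literature.MathematicalPhysics.QuantumFieldTheory.Balaban1983to89
open Literature.MathematicalPhysics.QuantumFieldTheory.Balaban1983to89.B7Prop1Explicit (e)
open Literature.MathematicalPhysics.QuantumFieldTheory.Balaban1983to89.B7Prop3Flat (insCfg)
open Literature.MathematicalPhysics.QuantumFieldTheory.Balaban1983to89.B7Prop4Flat (logIter)
open Literature.MathematicalPhysics.QuantumFieldTheory.Balaban1983to89.B7Prop5Flat (C3 C3_pos restr)
open Literature.MathematicalPhysics.QuantumFieldTheory.Balaban1983to89.B7Prop5FlatOperator (avgMap avgMap_apply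
  norm_insCfg_le_of_le analyticAt_avgMap_apply differentiableAt_avgMap_real opNorm_fderiv_real_avgMap_le)
open Literature.MathematicalPhysics.QuantumFieldTheory.Balaban1983to89.B12CauchyRemainder354 (norm_iteratedDeriv_le_of_ball
  hasDerivAt_comp_ofReal)
open Literature.MathematicalPhysics.QuantumFieldTheory.Balaban1983to89.B12Ineq417Flat (shiftCfg shiftCfg_apply shiftCfg_shiftCfg
  logIter_shiftCfg locB dlocB boxBonds oneBond theBond logIter_eq_avgMap_restr norm_logIter_le norm_logIter_shift_sub_le
  norm_shiftCfg_sub_le)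

namespace Literature.MathematicalPhysics.QuantumFieldTheory.Balaban1983to89.B12Ineq418Flat

variable {d : ℕ}

/-! ## §1 Mixed second differences of holomorphic functions: two one-variable Cauchy estimates -/

section Cauchy

variable {E F : Type*} [NormedAddCommGroup E] [NormedSpace ℂ E] [NormedAddCommGroup F] [NormedSpace ℂ F] [CompleteSpace F]

/-- **One complex variable**: if `g` is holomorphic on `ball 0 R`, `R > 1`, and `‖g‖ ≤ M` there, then `‖g(1) − g(0)‖ ≤ M/(R − 1)`
(Cauchy's estimate `‖g′(t)‖ ≤ M/(R − 1)` at the real points `t ∈ [0,1]`, whose `(R−1)`-discs lie in `ball 0 R`, then the real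
mean value inequality on `[0,1]`). [cite: Balaban1987RG1, (4.18) p.285] (elementary API for (4.18); our proof) -/
theorem norm_sub_le_of_ball {g : ℂ → F} {R M : ℝ} (hR : 1 < R) (hg : DifferentiableOn ℂ g (ball 0 R))
    (hM : ∀ z ∈ ball (0 : ℂ) R, ‖g z‖ ≤ M) : ‖g 1 - g 0‖ ≤ M / (R - 1) := by
  -- the `(R-1)`-disc around a point of `[0,1]` lies in `ball 0 R`
  have hsub : ∀ t ∈ Icc (0 : ℝ) 1, ball ((t : ℝ) : ℂ) (R - 1) ⊆ ball 0 R := by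
    intro t ht z hz
    rw [mem_ball, dist_zero_right]
    rw [mem_ball] at hz
    have ht1 : ‖((t : ℝ) : ℂ)‖ ≤ 1 := by
      rw [Complex.norm_real, Real.norm_of_nonneg ht.1]; exact ht.2
    calc ‖z‖ = ‖(z - (t : ℂ)) + (t : ℂ)‖ := by rw [sub_add_cancel]
      _ ≤ ‖z - (t : ℂ)‖ + ‖((t : ℝ) : ℂ)‖ := norm_add_le _ _
      _ < (R - 1) + 1 := add_lt_add_of_lt_of_le (by simpa [dist_eq_norm] using hz) ht1
      _ = R := by ring
  -- Cauchy's estimate for the first derivative at the real points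
  have hder : ∀ t ∈ Icc (0 : ℝ) 1, ‖deriv g ((t : ℝ) : ℂ)‖ ≤ M / (R - 1) := by
    intro t ht
    have h := norm_iteratedDeriv_le_of_ball (F := F) (by linarith : 0 < R - 1) (hg.mono (hsub t ht))
      (fun z hz => hM z (hsub t ht hz)) 1
    simpa [iteratedDeriv_one] using h
  -- the real mean value inequality on `[0,1]`
  have hderiv : ∀ t ∈ Icc (0 : ℝ) 1,
      HasDerivWithinAt (fun s : ℝ => g ((s : ℝ) : ℂ)) (deriv g ((t : ℝ) : ℂ)) (Icc (0 : ℝ) 1) t := by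
    intro t ht
    have hmem : ((t : ℝ) : ℂ) ∈ ball (0 : ℂ) R := hsub t ht (mem_ball_self (by linarith))
    have hdiff : DifferentiableAt ℂ g ((t : ℝ) : ℂ) := hg.differentiableAt (isOpen_ball.mem_nhds hmem)
    exact (hasDerivAt_comp_ofReal hdiff.hasDerivAt).hasDerivWithinAt
  have h := norm_image_sub_le_of_norm_deriv_le_segment' hderiv (fun t ht => hder t (Ico_subset_Icc_self ht)) 1
    (right_mem_Icc.2 zero_le_one)
  simpa using h

/-- **MIXED SECOND DIFFERENCES OF A HOLOMORPHIC FUNCTION**: for `f` holomorphic on an open `U ⊆ E` with `‖f‖ ≤ M` on `U`, and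
`p, V, W` such that `p + sV + tW ∈ U` whenever `|s|‖V‖ < ‖V‖ + r`, `|t|‖W‖ < ‖W‖ + r` (`r > 0`),
`‖f(p+V+W) − f(p+V) − f(p+W) + f(p)‖ ≤ M‖V‖‖W‖/r²` — `norm_sub_le_of_ball` in `t` for each `s` (radius `1 + r/‖W‖`), then in `s`
for `s ↦ f(p+sV+W) − f(p+sV)` (radius `1 + r/‖V‖`).  This replaces a bound on the second derivative of the averaging operation
in the proof of (4.18). [cite: Balaban1987RG1, (4.18) p.285] (elementary API for (4.18); our proof) -/
theorem norm_secondDiff_le {f : E → F} {U : Set E} (hU : IsOpen U) (hf : DifferentiableOn ℂ f U) {M r : ℝ} (hM0 : 0 ≤ M)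
    (hr : 0 < r) (p V W : E)
    (hmem : ∀ s t : ℂ, ‖s‖ * ‖V‖ < ‖V‖ + r → ‖t‖ * ‖W‖ < ‖W‖ + r → p + s • V + t • W ∈ U)
    (hM : ∀ q ∈ U, ‖f q‖ ≤ M) :
    ‖f (p + V + W) - f (p + V) - f (p + W) + f p‖ ≤ M * ‖V‖ * ‖W‖ / r ^ 2 := by
  have hRHS : 0 ≤ M * ‖V‖ * ‖W‖ / r ^ 2 := by positivity
  by_cases hV : V = 0
  · subst hV
    have : f (p + 0 + W) - f (p + 0) - f (p + W) + f p = 0 := by rw [add_zero]; abel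
    rw [this, norm_zero]; exact hRHS
  by_cases hW : W = 0
  · subst hW
    have : f (p + V + 0) - f (p + V) - f (p + 0) + f p = 0 := by rw [add_zero, add_zero]; abel
    rw [this, norm_zero]; exact hRHS
  have hVpos : 0 < ‖V‖ := norm_pos_iff.2 hV
  have hWpos : 0 < ‖W‖ := norm_pos_iff.2 hW
  -- radii of the parameter discs
  set Rs : ℝ := 1 + r / ‖V‖ with hRs
  set Rt : ℝ := 1 + r / ‖W‖ with hRt
  have hRs1 : 1 < Rs := by rw [hRs]; linarith [div_pos hr hVpos]
  have hRt1 : 1 < Rt := by rw [hRt]; linarith [div_pos hr hWpos]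
  have hsV : ∀ s : ℂ, ‖s‖ < Rs → ‖s‖ * ‖V‖ < ‖V‖ + r := by
    intro s hs
    have := mul_lt_mul_of_pos_right hs hVpos
    rwa [hRs, add_mul, one_mul, div_mul_cancel₀ _ hVpos.ne'] at this
  have htW : ∀ t : ℂ, ‖t‖ < Rt → ‖t‖ * ‖W‖ < ‖W‖ + r := by
    intro t ht
    have := mul_lt_mul_of_pos_right ht hWpos
    rwa [hRt, add_mul, one_mul, div_mul_cancel₀ _ hWpos.ne'] at this
  -- Step 1: for each admissible `s`, `‖f(p+sV+W) − f(p+sV)‖ ≤ M‖W‖/r`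
  have step1 : ∀ s : ℂ, ‖s‖ < Rs → ‖f (p + s • V + W) - f (p + s • V)‖ ≤ M * ‖W‖ / r := by
    intro s hs
    set g : ℂ → F := fun t => f (p + s • V + t • W) with hg
    have hgdiff : DifferentiableOn ℂ g (ball 0 Rt) := by
      intro t ht
      rw [mem_ball, dist_zero_right] at ht
      have hq : p + s • V + t • W ∈ U := hmem s t (hsV s hs) (htW t ht)
      have hft : DifferentiableAt ℂ f (p + s • V + t • W) := hf.differentiableAt (hU.mem_nhds hq)
      have haff : DifferentiableAt ℂ (fun t : ℂ => p + s • V + t • W) t :=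
        ((differentiableAt_id.smul_const W).const_add (p + s • V))
      exact (hft.comp t haff).differentiableWithinAt
    have hgM : ∀ t ∈ ball (0 : ℂ) Rt, ‖g t‖ ≤ M := by
      intro t ht
      rw [mem_ball, dist_zero_right] at ht
      exact hM _ (hmem s t (hsV s hs) (htW t ht))
    have h := norm_sub_le_of_ball hRt1 hgdiff hgM
    have hg1 : g 1 = f (p + s • V + W) := by simp [hg]
    have hg0 : g 0 = f (p + s • V) := by simp [hg]
    rw [hg1, hg0] at h
    refine h.trans (le_of_eq ?_)
    rw [hRt, add_sub_cancel_left, div_div_eq_mul_div]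
  -- Step 2: the same in `s` for `ψ(s) = f(p+sV+W) − f(p+sV)`
  set ψ : ℂ → F := fun s => f (p + s • V + W) - f (p + s • V) with hψ
  have hψdiff : DifferentiableOn ℂ ψ (ball 0 Rs) := by
    intro s hs
    rw [mem_ball, dist_zero_right] at hs
    have h1 : p + s • V + (1 : ℂ) • W ∈ U := hmem s 1 (hsV s hs) (htW 1 (by simpa using hRt1))
    have h0 : p + s • V + (0 : ℂ) • W ∈ U := hmem s 0 (hsV s hs) (htW 0 (by simpa using zero_lt_one.trans hRt1))
    rw [one_smul] at h1
    rw [zero_smul, add_zero] at h0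
    have hf1 : DifferentiableAt ℂ f (p + s • V + W) := hf.differentiableAt (hU.mem_nhds h1)
    have hf0 : DifferentiableAt ℂ f (p + s • V) := hf.differentiableAt (hU.mem_nhds h0)
    have haff0 : DifferentiableAt ℂ (fun s : ℂ => p + s • V) s := (differentiableAt_id.smul_const V).const_add p
    have haff1 : DifferentiableAt ℂ (fun s : ℂ => p + s • V + W) s := haff0.add_const W
    exact ((hf1.comp s haff1).sub (hf0.comp s haff0)).differentiableWithinAt
  have hψM : ∀ s ∈ ball (0 : ℂ) Rs, ‖ψ s‖ ≤ M * ‖W‖ / r := by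
    intro s hs
    rw [mem_ball, dist_zero_right] at hs
    exact step1 s hs
  have h2 := norm_sub_le_of_ball hRs1 hψdiff hψM
  have hψ1 : ψ 1 = f (p + V + W) - f (p + V) := by simp [hψ]
  have hψ0 : ψ 0 = f (p + W) - f p := by simp [hψ]
  rw [hψ1, hψ0] at h2
  have hrew : f (p + V + W) - f (p + V) - f (p + W) + f p = (f (p + V + W) - f (p + V)) - (f (p + W) - f p) := by abel
  rw [hrew]
  refine h2.trans (le_of_eq ?_)
  rw [hRs, add_sub_cancel_left]
  field_simp

end Cauchy

/-! ## §2 Second differences on the lattice: `∂_λ∂_νB_μ`, the product rule, the double difference of the fine field -/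

section Lattice

variable {𝔸 : Type*} [NormedRing 𝔸] [NormedAlgebra ℂ 𝔸] [CompleteSpace 𝔸]

/-- **The second unit-lattice derivative** `(∂_λ∂_νB_μ)(x) = (∂_νB_μ)(x + e_λ) − (∂_νB_μ)(x)` of the localized field
`B_μ = ζ̃_□·Q_{j,μ}(B, ·)` (`B12Ineq417Flat.locB`/`dlocB`). [cite: Balaban1987RG1, (4.18) p.285] -/
def ddlocB (ζ : B7Prop1Explicit.Site d → ℝ) (L : ℕ) (B : B7Prop1Explicit.Site d → Fin d → 𝔸) (j : ℕ) (lam ν : Fin d)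
    (z : B7Prop1Explicit.Site d) (μ : Fin d) : 𝔸 :=
  dlocB ζ L B j ν (z + e lam) μ - dlocB ζ L B j ν z μ

/-- **Product rule for the mixed second difference** of `ζ̃·Q` (`Q = Q_j(1, B)(·, μ)` on the unit lattice):
`Δ_λΔ_ν(ζ̃Q)(z) = ζ̃(z)·[Q(z+e_λ+e_ν) − Q(z+e_λ) − Q(z+e_ν) + Q(z)] + [ζ̃(z+e_λ) − ζ̃(z)]·[Q(z+e_λ+e_ν) − Q(z+e_λ)]
  + [ζ̃(z+e_ν) − ζ̃(z)]·[Q(z+e_λ+e_ν) − Q(z+e_ν)] + [ζ̃(z+e_λ+e_ν) − ζ̃(z+e_λ) − ζ̃(z+e_ν) + ζ̃(z)]·Q(z+e_λ+e_ν)`.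
[cite: Balaban1987RG1, (4.18) p.285] (elementary API; our proof) -/
theorem eq418_split (ζ : B7Prop1Explicit.Site d → ℝ) (L : ℕ) (B : B7Prop1Explicit.Site d → Fin d → 𝔸) (j : ℕ)
    (lam ν : Fin d) (z : B7Prop1Explicit.Site d) (μ : Fin d) :
    ddlocB ζ L B j lam ν z μ
      = ζ z • (logIter L B j (z + e lam + e ν) μ - logIter L B j (z + e lam) μ - logIter L B j (z + e ν) μ
          + logIter L B j z μ)
        + (ζ (z + e lam) - ζ z) • (logIter L B j (z + e lam + e ν) μ - logIter L B j (z + e lam) μ)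
        + (ζ (z + e ν) - ζ z) • (logIter L B j (z + e lam + e ν) μ - logIter L B j (z + e ν) μ)
        + (ζ (z + e lam + e ν) - ζ (z + e lam) - ζ (z + e ν) + ζ z) • logIter L B j (z + e lam + e ν) μ := by
  simp only [ddlocB, dlocB, locB]
  module

/-- **The double difference of the fine field**: `(t_{a+a′}B − t_aB − t_{a′}B + B)(x′)`.
[cite: Balaban1987RG1, (4.18) p.285] -/
def dd2Cfg (a a' : B7Prop1Explicit.Site d) (B : B7Prop1Explicit.Site d → Fin d → 𝔸) :
    B7Prop1Explicit.Site d → Fin d → 𝔸 :=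
  shiftCfg (a + a') B - shiftCfg a B - shiftCfg a' B + B

omit [NormedAlgebra ℂ 𝔸] [CompleteSpace 𝔸] in
/-- The double difference as a single difference of fine gradients summed along the coarse `ν`-step:
`(t_{a+ne_ν}B − t_aB − t_{ne_ν}B + B)(x′) = Σ_{m<n} [∇_νB(x′ + a + me_ν) − ∇_νB(x′ + me_ν)]`, `∇_νB(y) = B(y+e_ν) − B(y)`.
[cite: Balaban1987RG1, (4.18) p.285] (elementary API; our proof) -/
theorem dd2Cfg_eq_sum (a : B7Prop1Explicit.Site d) (n : ℕ) (ν : Fin d) (B : B7Prop1Explicit.Site d → Fin d → 𝔸)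
    (x : B7Prop1Explicit.Site d) (κ : Fin d) :
    dd2Cfg a ((n : ℤ) • e ν) B x κ
      = ∑ m ∈ Finset.range n,
          ((B (x + a + (m : ℤ) • e ν + e ν) κ - B (x + a + (m : ℤ) • e ν) κ)
            - (B (x + (m : ℤ) • e ν + e ν) κ - B (x + (m : ℤ) • e ν) κ)) := by
  have h1 := B12Ineq417Flat.shiftCfg_sub_eq_sum n ν (fun y => B (y + a) κ) x
  have h2 := B12Ineq417Flat.shiftCfg_sub_eq_sum n ν (fun y => B y κ) x
  simp only [shiftCfg_apply] at h1 h2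
  have hL : dd2Cfg a ((n : ℤ) • e ν) B x κ
      = (B (x + (n : ℤ) • e ν + a) κ - B (x + a) κ) - (B (x + (n : ℤ) • e ν) κ - B x κ) := by
    simp only [dd2Cfg, Pi.add_apply, Pi.sub_apply, shiftCfg_apply]
    rw [show x + (a + (n : ℤ) • e ν) = x + (n : ℤ) • e ν + a by abel]
    abel
  rw [hL, h1, h2, ← Finset.sum_sub_distrib]
  refine Finset.sum_congr rfl fun m _ => ?_
  simp only [Nat.cast_add, Nat.cast_one, add_smul, one_smul]
  rw [show x + ((m : ℤ) • e ν + e ν) + a = x + a + (m : ℤ) • e ν + e ν by abel,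
    show x + (m : ℤ) • e ν + a = x + a + (m : ℤ) • e ν by abel,
    show x + ((m : ℤ) • e ν + e ν) = x + (m : ℤ) • e ν + e ν by abel]

omit [NormedAlgebra ℂ 𝔸] [CompleteSpace 𝔸] in
/-- **Size of the double difference**: if the coarse variation of the fine `ν`-gradient across `a` is `≤ g₂`, i.e.
`‖∇_νB(y + a) − ∇_νB(y)‖ ≤ g₂` for all `y`, then `‖(t_{a+ne_ν}B − t_aB − t_{ne_ν}B + B)(x′)‖ ≤ n·g₂` (print: the Hölder norm of
the first derivatives of `A` in (3.32), over the distance `|a| = L^jη`). [cite: Balaban1987RG1, (4.18) p.285] -/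
theorem norm_dd2Cfg_le (a : B7Prop1Explicit.Site d) (n : ℕ) (ν : Fin d) (B : B7Prop1Explicit.Site d → Fin d → 𝔸)
    {g₂ : ℝ} (hg₂ : ∀ y κ, ‖(B (y + a + e ν) κ - B (y + a) κ) - (B (y + e ν) κ - B y κ)‖ ≤ g₂)
    (x : B7Prop1Explicit.Site d) (κ : Fin d) : ‖dd2Cfg a ((n : ℤ) • e ν) B x κ‖ ≤ n * g₂ := by
  rw [dd2Cfg_eq_sum]
  refine (norm_sum_le _ _).trans ?_
  calc ∑ m ∈ Finset.range n, ‖(B (x + a + (m : ℤ) • e ν + e ν) κ - B (x + a + (m : ℤ) • e ν) κ)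
            - (B (x + (m : ℤ) • e ν + e ν) κ - B (x + (m : ℤ) • e ν) κ)‖
      ≤ ∑ _m ∈ Finset.range n, g₂ := Finset.sum_le_sum fun m _ => by
          have h := hg₂ (x + (m : ℤ) • e ν) κ
          rwa [show x + (m : ℤ) • e ν + a = x + a + (m : ℤ) • e ν by abel] at h
    _ = n * g₂ := by simp

/-- **The four-point decomposition** of the mixed second difference of `Q = Q_j(1, ·)(c)`, `c = ⟨x, x+e_μ⟩`: with
`f = avgMap L S {c} j (·)(c)`, `S` the bonds of the box of `c`, and points `p = B|S`, `p + V = (t_{a_λ}B)|S`, `p + W = (t_{a_ν}B)|S`,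
`p + V + W + Z = (t_{a_λ+a_ν}B)|S` of `𝔸^S`,
`Q(z+e_λ+e_ν) − Q(z+e_λ) − Q(z+e_ν) + Q(z) = [f(p+V+W+Z) − f(p+V+W)] + [f(p+V+W) − f(p+V) − f(p+W) + f(p)]`
(translation covariance `B12Ineq417Flat.logIter_shiftCfg` + locality `B12Ineq417Flat.logIter_eq_avgMap_restr`).
[cite: Balaban1987RG1, (4.18) p.285; Balaban1985Averaging, p.24, (127) p.37] -/
theorem secondDiff_logIter_eq (L : ℕ) (hL : 1 ≤ L) (B : B7Prop1Explicit.Site d → Fin d → 𝔸) (j : ℕ) (lam ν : Fin d)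
    (z : B7Prop1Explicit.Site d) (μ : Fin d) (p V W Z : boxBonds L j z μ → 𝔸) (hp : p = restr (boxBonds L j z μ) B)
    (hV : p + V = restr (boxBonds L j z μ) (shiftCfg (((L : ℤ) ^ j) • e lam) B))
    (hW : p + W = restr (boxBonds L j z μ) (shiftCfg (((L : ℤ) ^ j) • e ν) B))
    (hZ : p + V + W + Z = restr (boxBonds L j z μ) (shiftCfg (((L : ℤ) ^ j) • e lam + ((L : ℤ) ^ j) • e ν) B)) :
    logIter L B j (z + e lam + e ν) μ - logIter L B j (z + e lam) μ - logIter L B j (z + e ν) μ + logIter L B j z μ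
      = (avgMap L (boxBonds L j z μ) (oneBond z μ) j (p + V + W + Z) (theBond z μ)
          - avgMap L (boxBonds L j z μ) (oneBond z μ) j (p + V + W) (theBond z μ))
        + (avgMap L (boxBonds L j z μ) (oneBond z μ) j (p + V + W) (theBond z μ)
          - avgMap L (boxBonds L j z μ) (oneBond z μ) j (p + V) (theBond z μ)
          - avgMap L (boxBonds L j z μ) (oneBond z μ) j (p + W) (theBond z μ)
          + avgMap L (boxBonds L j z μ) (oneBond z μ) j p (theBond z μ)) := by
  have h00 : logIter L B j z μ = avgMap L (boxBonds L j z μ) (oneBond z μ) j p (theBond z μ) := by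
    rw [hp]; exact logIter_eq_avgMap_restr L hL B j z μ
  have h10 : logIter L B j (z + e lam) μ = avgMap L (boxBonds L j z μ) (oneBond z μ) j (p + V) (theBond z μ) := by
    rw [hV, logIter_shiftCfg L B j (e lam) z μ]; exact logIter_eq_avgMap_restr L hL _ j z μ
  have h01 : logIter L B j (z + e ν) μ = avgMap L (boxBonds L j z μ) (oneBond z μ) j (p + W) (theBond z μ) := by
    rw [hW, logIter_shiftCfg L B j (e ν) z μ]; exact logIter_eq_avgMap_restr L hL _ j z μ
  have h11 : logIter L B j (z + e lam + e ν) μ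
      = avgMap L (boxBonds L j z μ) (oneBond z μ) j (p + V + W + Z) (theBond z μ) := by
    rw [hZ, add_assoc, logIter_shiftCfg L B j (e lam + e ν) z μ, smul_add]; exact logIter_eq_avgMap_restr L hL _ j z μ
  rw [h00, h10, h01, h11]
  abel

end Lattice

/-! ## §3 (4.18) at the flat background -/

section Ineq418

variable {𝔸 : Type*} [NormedRing 𝔸] [NormedAlgebra ℂ 𝔸] [CompleteSpace 𝔸]

omit [NormedAlgebra ℂ 𝔸] [CompleteSpace 𝔸] in
/-- `sup ‖·‖ ≤ m` passes to the restriction (sup norm of `𝔸^S`). [folklore] -/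
private theorem norm_restr_le {S : Finset (B7Prop1Explicit.Site d × Fin d)} {F : B7Prop1Explicit.Site d → Fin d → 𝔸}
    {m : ℝ} (hm : 0 ≤ m) (hF : ∀ x κ, ‖F x κ‖ ≤ m) : ‖restr S F‖ ≤ m :=
  (pi_norm_le_iff_of_nonneg hm).2 fun s => hF s.1.1 s.1.2

/-- **The mixed second difference of the concrete `Q_j(1, ·)`** («similar considerations as in the proof of (4.17)», with the
second-order input from analyticity): for `L ≥ 2`, `C₃L^jb₁ ≤ 1`, `sup ‖B‖ ≤ b`, fine `λ`- and `ν`-differences `≤ g`, coarse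
variation of the fine `ν`-gradient across `a_λ = L^je_λ` `≤ g₂`, and a margin `r > 0` with `b + 2L^jg + 2r ≤ b₁`,
`‖Q(z+e_λ+e_ν) − Q(z+e_λ) − Q(z+e_ν) + Q(z)‖ ≤ 2dL^j(1 + C₃L^jb₁)·L^jg₂ + 2L^jb₁·(L^jg)²/r²`.
[cite: Balaban1987RG1, (4.18) p.285; Balaban1985Averaging, Prop. 4 p.38, Prop. 5 (156) p.42, (131) p.38] -/
theorem norm_secondDiff_logIter_le (L : ℕ) (hL : 2 ≤ L) (B : B7Prop1Explicit.Site d → Fin d → 𝔸) (j : ℕ) (lam ν : Fin d)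
    (z : B7Prop1Explicit.Site d) (μ : Fin d) {b b₁ g g₂ r : ℝ} (hb : 0 ≤ b) (hg : 0 ≤ g) (hg₂ : 0 ≤ g₂) (hr : 0 < r)
    (hk : C3 d L * ((L : ℝ) ^ j * b₁) ≤ 1) (hroom : b + 2 * ((L : ℝ) ^ j * g) + 2 * r ≤ b₁)
    (hB : ∀ x κ, ‖B x κ‖ ≤ b) (hgLam : ∀ x κ, ‖B (x + e lam) κ - B x κ‖ ≤ g) (hgν : ∀ x κ, ‖B (x + e ν) κ - B x κ‖ ≤ g)
    (hG : ∀ y κ, ‖(B (y + ((L : ℤ) ^ j) • e lam + e ν) κ - B (y + ((L : ℤ) ^ j) • e lam) κ) - (B (y + e ν) κ - B y κ)‖ ≤ g₂) :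
    ‖logIter L B j (z + e lam + e ν) μ - logIter L B j (z + e lam) μ - logIter L B j (z + e ν) μ + logIter L B j z μ‖
      ≤ 2 * d * (L : ℝ) ^ j * (1 + C3 d L * ((L : ℝ) ^ j * b₁)) * ((L : ℝ) ^ j * g₂)
        + 2 * ((L : ℝ) ^ j * b₁) * ((L : ℝ) ^ j * g) * ((L : ℝ) ^ j * g) / r ^ 2 := by
  have hL1 : 1 ≤ L := le_trans (by norm_num) hL
  have hLj : (0 : ℝ) ≤ (L : ℝ) ^ j := by positivity
  have hLg : 0 ≤ (L : ℝ) ^ j * g := mul_nonneg hLj hg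
  have hb₁ : b ≤ b₁ := by linarith
  have hb₁0 : 0 ≤ b₁ := hb.trans hb₁
  have hC3 := C3_pos d L hL1
  -- the index set, the two translations and the four points of `𝔸^S`
  set S := boxBonds L j z μ with hS
  set aLam : B7Prop1Explicit.Site d := ((L : ℤ) ^ j) • e lam with haLam
  set aNu : B7Prop1Explicit.Site d := ((L : ℤ) ^ j) • e ν with haNu
  set p : S → 𝔸 := restr S B with hp
  set V : S → 𝔸 := restr S (shiftCfg aLam B) - p with hV
  set W : S → 𝔸 := restr S (shiftCfg aNu B) - p with hW
  set Z : S → 𝔸 := restr S (shiftCfg (aLam + aNu) B) - (p + V + W) with hZ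
  have hpV : p + V = restr S (shiftCfg aLam B) := by rw [hV]; abel
  have hpW : p + W = restr S (shiftCfg aNu B) := by rw [hW]; abel
  have hpVWZ : p + V + W + Z = restr S (shiftCfg (aLam + aNu) B) := by rw [hZ]; abel
  have hVeq : V = restr S (shiftCfg aLam B - B) := by rw [hV, hp]; funext s; simp [restr]
  have hWeq : W = restr S (shiftCfg aNu B - B) := by rw [hW, hp]; funext s; simp [restr]
  have hZeq : Z = restr S (dd2Cfg aLam aNu B) := by
    rw [hZ, hV, hW, hp]; funext s; simp [restr, dd2Cfg]; abel
  have hpVW : p + V + W = restr S (shiftCfg aLam B + shiftCfg aNu B - B) := by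
    rw [hV, hW, hp]; funext s; simp [restr]; abel
  rw [secondDiff_logIter_eq L hL1 B j lam ν z μ p V W Z hp hpV hpW hpVWZ]
  -- sizes of the restricted vectors
  have hmLam : ∀ x κ, ‖(shiftCfg aLam B - B) x κ‖ ≤ (L : ℝ) ^ j * g := by
    intro x κ
    have h := norm_shiftCfg_sub_le lam (fun y => B y κ) (fun y => hgLam y κ) (L ^ j) x
    have hcast : (((L ^ j : ℕ) : ℤ)) • e lam = aLam := by rw [haLam]; push_cast; rfl
    rw [hcast] at h
    simpa [shiftCfg] using h
  have hmν : ∀ x κ, ‖(shiftCfg aNu B - B) x κ‖ ≤ (L : ℝ) ^ j * g := by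
    intro x κ
    have h := norm_shiftCfg_sub_le ν (fun y => B y κ) (fun y => hgν y κ) (L ^ j) x
    have hcast : (((L ^ j : ℕ) : ℤ)) • e ν = aNu := by rw [haNu]; push_cast; rfl
    rw [hcast] at h
    simpa [shiftCfg] using h
  have hmZ : ∀ x κ, ‖dd2Cfg aLam aNu B x κ‖ ≤ (L : ℝ) ^ j * g₂ := by
    intro x κ
    have h := norm_dd2Cfg_le aLam (L ^ j) ν B hG x κ
    have hcast : (((L ^ j : ℕ) : ℤ)) • e ν = aNu := by rw [haNu]; push_cast; rfl
    rw [hcast] at h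
    simpa using h
  have hVn : ‖V‖ ≤ (L : ℝ) ^ j * g := by rw [hVeq]; exact norm_restr_le hLg hmLam
  have hWn : ‖W‖ ≤ (L : ℝ) ^ j * g := by rw [hWeq]; exact norm_restr_le hLg hmν
  have hZn : ‖Z‖ ≤ (L : ℝ) ^ j * g₂ := by rw [hZeq]; exact norm_restr_le (mul_nonneg hLj hg₂) hmZ
  have hpn : ‖p‖ ≤ b := norm_restr_le hb hB
  -- (i) the first bracket: mean value inequality with Prop. 5 in operator form on the closed polydisc of radius `b₁`
  have hK : Convex ℝ {y : S → 𝔸 | ∀ s, ‖y s‖ ≤ b₁} := by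
    intro y hy y' hy' s t hs ht hst i
    calc ‖(s • y + t • y') i‖ = ‖s • y i + t • y' i‖ := rfl
      _ ≤ ‖s • y i‖ + ‖t • y' i‖ := norm_add_le _ _
      _ = s * ‖y i‖ + t * ‖y' i‖ := by rw [norm_smul, norm_smul, Real.norm_of_nonneg hs, Real.norm_of_nonneg ht]
      _ ≤ s * b₁ + t * b₁ := add_le_add (mul_le_mul_of_nonneg_left (hy i) hs) (mul_le_mul_of_nonneg_left (hy' i) ht)
      _ = b₁ := by rw [← add_mul, hst, one_mul]
  have hmemVW : p + V + W ∈ {y : S → 𝔸 | ∀ s, ‖y s‖ ≤ b₁} := by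
    intro s
    calc ‖(p + V + W) s‖ ≤ ‖p + V + W‖ := norm_le_pi_norm _ s
      _ ≤ ‖p‖ + ‖V‖ + ‖W‖ := (norm_add_le _ _).trans (add_le_add (norm_add_le _ _) le_rfl)
      _ ≤ b + (L : ℝ) ^ j * g + (L : ℝ) ^ j * g := by linarith
      _ ≤ b₁ := by linarith
  have hmemVWZ : p + V + W + Z ∈ {y : S → 𝔸 | ∀ s, ‖y s‖ ≤ b₁} := by
    intro s
    rw [hpVWZ]
    simpa [restr, shiftCfg] using (hB (s.1.1 + (aLam + aNu)) s.1.2).trans hb₁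
  have hdiffK : ∀ y ∈ {y : S → 𝔸 | ∀ s, ‖y s‖ ≤ b₁}, DifferentiableAt ℝ (avgMap L S (oneBond z μ) j) y :=
    fun y hy => differentiableAt_avgMap_real L hL S (oneBond z μ) j hb₁0 hk hy
  have hboundK : ∀ y ∈ {y : S → 𝔸 | ∀ s, ‖y s‖ ≤ b₁},
      ‖fderiv ℝ (avgMap L S (oneBond z μ) j) y‖ ≤ 2 * d * (L : ℝ) ^ j * (1 + C3 d L * ((L : ℝ) ^ j * b₁)) :=
    fun y hy => opNorm_fderiv_real_avgMap_le L hL S (oneBond z μ) j hb₁0 hk hy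
  have hmvt := hK.norm_image_sub_le_of_norm_fderiv_le hdiffK hboundK hmemVW hmemVWZ
  have hD0 : 0 ≤ 2 * d * (L : ℝ) ^ j * (1 + C3 d L * ((L : ℝ) ^ j * b₁)) := by positivity
  have hfirst : ‖avgMap L S (oneBond z μ) j (p + V + W + Z) (theBond z μ) - avgMap L S (oneBond z μ) j (p + V + W) (theBond z μ)‖
      ≤ 2 * d * (L : ℝ) ^ j * (1 + C3 d L * ((L : ℝ) ^ j * b₁)) * ((L : ℝ) ^ j * g₂) := by
    calc ‖avgMap L S (oneBond z μ) j (p + V + W + Z) (theBond z μ) - avgMap L S (oneBond z μ) j (p + V + W) (theBond z μ)‖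
        = ‖(avgMap L S (oneBond z μ) j (p + V + W + Z) - avgMap L S (oneBond z μ) j (p + V + W)) (theBond z μ)‖ := rfl
      _ ≤ ‖avgMap L S (oneBond z μ) j (p + V + W + Z) - avgMap L S (oneBond z μ) j (p + V + W)‖ := norm_le_pi_norm _ _
      _ ≤ 2 * d * (L : ℝ) ^ j * (1 + C3 d L * ((L : ℝ) ^ j * b₁)) * ‖p + V + W + Z - (p + V + W)‖ := hmvt
      _ = 2 * d * (L : ℝ) ^ j * (1 + C3 d L * ((L : ℝ) ^ j * b₁)) * ‖Z‖ := by rw [add_sub_cancel_left]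
      _ ≤ 2 * d * (L : ℝ) ^ j * (1 + C3 d L * ((L : ℝ) ^ j * b₁)) * ((L : ℝ) ^ j * g₂) :=
          mul_le_mul_of_nonneg_left hZn hD0
  -- (ii) the second bracket: the Cauchy square on the OPEN polydisc of radius `b₁`
  have hU : IsOpen {y : S → 𝔸 | ∀ s, ‖y s‖ < b₁} := B7Prop4Flat.isOpen_polydisc S b₁
  have hfU : DifferentiableOn ℂ (fun q : S → 𝔸 => avgMap L S (oneBond z μ) j q (theBond z μ))
      {y : S → 𝔸 | ∀ s, ‖y s‖ < b₁} := fun y hy =>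
    (analyticAt_avgMap_apply L hL S (oneBond z μ) j hb₁0 hk (fun s => (hy s).le) (theBond z μ)).differentiableAt
      |>.differentiableWithinAt
  have hMU : ∀ q ∈ {y : S → 𝔸 | ∀ s, ‖y s‖ < b₁}, ‖avgMap L S (oneBond z μ) j q (theBond z μ)‖ ≤ 2 * ((L : ℝ) ^ j * b₁) := by
    intro q hq
    have hins : ∀ x κ, ‖insCfg S q x κ‖ ≤ b₁ := norm_insCfg_le_of_le hb₁0 fun s => (hq s).le
    simpa [avgMap_apply, theBond] using norm_logIter_le L hL (insCfg S q) j hb₁0 hk hins z μ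
  have hmem : ∀ s t : ℂ, ‖s‖ * ‖V‖ < ‖V‖ + r → ‖t‖ * ‖W‖ < ‖W‖ + r →
      p + s • V + t • W ∈ {y : S → 𝔸 | ∀ s, ‖y s‖ < b₁} := by
    intro s t hs ht i
    calc ‖(p + s • V + t • W) i‖ ≤ ‖p + s • V + t • W‖ := norm_le_pi_norm _ i
      _ ≤ ‖p‖ + ‖s • V‖ + ‖t • W‖ := (norm_add_le _ _).trans (add_le_add (norm_add_le _ _) le_rfl)
      _ = ‖p‖ + ‖s‖ * ‖V‖ + ‖t‖ * ‖W‖ := by rw [norm_smul, norm_smul]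
      _ < b + ((L : ℝ) ^ j * g + r) + ((L : ℝ) ^ j * g + r) := by
          have h1 : ‖s‖ * ‖V‖ < (L : ℝ) ^ j * g + r := lt_of_lt_of_le hs (by linarith)
          have h2 : ‖t‖ * ‖W‖ < (L : ℝ) ^ j * g + r := lt_of_lt_of_le ht (by linarith)
          linarith
      _ ≤ b₁ := by linarith
  have hsecond := norm_secondDiff_le hU hfU (by positivity : (0 : ℝ) ≤ 2 * ((L : ℝ) ^ j * b₁)) hr p V W hmem hMU
  have hsecond' : ‖avgMap L S (oneBond z μ) j (p + V + W) (theBond z μ) - avgMap L S (oneBond z μ) j (p + V) (theBond z μ)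
        - avgMap L S (oneBond z μ) j (p + W) (theBond z μ) + avgMap L S (oneBond z μ) j p (theBond z μ)‖
      ≤ 2 * ((L : ℝ) ^ j * b₁) * ((L : ℝ) ^ j * g) * ((L : ℝ) ^ j * g) / r ^ 2 := by
    refine hsecond.trans ?_
    have : 2 * ((L : ℝ) ^ j * b₁) * ‖V‖ * ‖W‖ ≤ 2 * ((L : ℝ) ^ j * b₁) * ((L : ℝ) ^ j * g) * ((L : ℝ) ^ j * g) := by
      have h1 : 2 * ((L : ℝ) ^ j * b₁) * ‖V‖ ≤ 2 * ((L : ℝ) ^ j * b₁) * ((L : ℝ) ^ j * g) :=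
        mul_le_mul_of_nonneg_left hVn (by positivity)
      exact mul_le_mul h1 hWn (norm_nonneg _) (by positivity)
    exact div_le_div_of_nonneg_right this (by positivity)
  exact (norm_add_le _ _).trans (add_le_add hfirst hsecond')

/-- **(4.18) AT THE FLAT BACKGROUND for the concrete `Q_j(1, ·)`** («|(∂_λ∂_νB_μ)(x)| < α₁(L^jη)^{2+β} … by similar considerations
as in the proof of (4.17)»): with the sizes of the DICTIONARY — `sup ‖B‖ ≤ b`, fine differences `≤ g`, coarse variation of the
fine gradient `≤ g₂` (the Hölder input), `|ζ̃(z)| ≤ 1`, coarse differences of `ζ̃` `≤ δ₁`, mixed second difference `≤ δ₂`, radius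
`b₁` with `C₃(d,L)L^jb₁ ≤ 1` and margin `b + 2L^jg + 2r ≤ b₁` —
`‖(∂_λ∂_νB_μ)(z)‖ ≤ [2dL^j(1 + C₃L^jb₁)L^jg₂ + 2L^jb₁(L^jg)²/r²] + 2δ₁·2dL^j(1 + C₃L^jb)L^jg + δ₂·2L^jb`.
[cite: Balaban1987RG1, (4.18) p.285; Balaban1985Averaging, Prop. 4 p.38, Prop. 5 (156) p.42] -/
theorem ineq418_flat (ζ : B7Prop1Explicit.Site d → ℝ) (L : ℕ) (hL : 2 ≤ L) (B : B7Prop1Explicit.Site d → Fin d → 𝔸)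
    (j : ℕ) (lam ν : Fin d) (z : B7Prop1Explicit.Site d) (μ : Fin d) {b b₁ g g₂ r δ₁ δ₂ : ℝ} (hb : 0 ≤ b) (hg : 0 ≤ g)
    (hg₂ : 0 ≤ g₂) (hr : 0 < r) (hk : C3 d L * ((L : ℝ) ^ j * b₁) ≤ 1)
    (hroom : b + 2 * ((L : ℝ) ^ j * g) + 2 * r ≤ b₁) (hB : ∀ x κ, ‖B x κ‖ ≤ b)
    (hgLam : ∀ x κ, ‖B (x + e lam) κ - B x κ‖ ≤ g) (hgν : ∀ x κ, ‖B (x + e ν) κ - B x κ‖ ≤ g)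
    (hG : ∀ y κ, ‖(B (y + ((L : ℤ) ^ j) • e lam + e ν) κ - B (y + ((L : ℤ) ^ j) • e lam) κ) - (B (y + e ν) κ - B y κ)‖ ≤ g₂)
    (hζ0 : |ζ z| ≤ 1) (hζLam : |ζ (z + e lam) - ζ z| ≤ δ₁) (hζν : |ζ (z + e ν) - ζ z| ≤ δ₁)
    (hζ2 : |ζ (z + e lam + e ν) - ζ (z + e lam) - ζ (z + e ν) + ζ z| ≤ δ₂) :
    ‖ddlocB ζ L B j lam ν z μ‖
      ≤ (2 * d * (L : ℝ) ^ j * (1 + C3 d L * ((L : ℝ) ^ j * b₁)) * ((L : ℝ) ^ j * g₂)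
          + 2 * ((L : ℝ) ^ j * b₁) * ((L : ℝ) ^ j * g) * ((L : ℝ) ^ j * g) / r ^ 2)
        + 2 * (δ₁ * (2 * d * (L : ℝ) ^ j * (1 + C3 d L * ((L : ℝ) ^ j * b)) * ((L : ℝ) ^ j * g)))
        + δ₂ * (2 * ((L : ℝ) ^ j * b)) := by
  have hL1 : 1 ≤ L := le_trans (by norm_num) hL
  have hC3 := C3_pos d L hL1
  have hLj : (0 : ℝ) ≤ (L : ℝ) ^ j := by positivity
  have hLg : 0 ≤ (L : ℝ) ^ j * g := mul_nonneg hLj hg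
  have hb₁ : b ≤ b₁ := by linarith
  have hkb : C3 d L * ((L : ℝ) ^ j * b) ≤ 1 :=
    (mul_le_mul_of_nonneg_left (mul_le_mul_of_nonneg_left hb₁ hLj) hC3.le).trans hk
  -- fine differences of the translated fields
  have hmν : ∀ x κ, ‖shiftCfg (((L : ℤ) ^ j) • e ν) B x κ - B x κ‖ ≤ (L : ℝ) ^ j * g := by
    intro x κ
    have h := norm_shiftCfg_sub_le ν (fun y => B y κ) (fun y => hgν y κ) (L ^ j) x
    have hcast : (((L ^ j : ℕ) : ℤ)) • e ν = ((L : ℤ) ^ j) • e ν := by push_cast; rfl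
    rw [hcast] at h
    simpa [shiftCfg] using h
  have hmLam : ∀ x κ, ‖shiftCfg (((L : ℤ) ^ j) • e lam) B x κ - B x κ‖ ≤ (L : ℝ) ^ j * g := by
    intro x κ
    have h := norm_shiftCfg_sub_le lam (fun y => B y κ) (fun y => hgLam y κ) (L ^ j) x
    have hcast : (((L ^ j : ℕ) : ℤ)) • e lam = ((L : ℤ) ^ j) • e lam := by push_cast; rfl
    rw [hcast] at h
    simpa [shiftCfg] using h
  -- `Q(z+e_λ+e_ν) − Q(z+e_λ)`: a coarse `ν`-step at the translated field `t_{a_λ}B`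
  have hDν : ‖logIter L B j (z + e lam + e ν) μ - logIter L B j (z + e lam) μ‖
      ≤ 2 * d * (L : ℝ) ^ j * (1 + C3 d L * ((L : ℝ) ^ j * b)) * ((L : ℝ) ^ j * g) := by
    have hBLam : ∀ x κ, ‖shiftCfg (((L : ℤ) ^ j) • e lam) B x κ‖ ≤ b := fun x κ => by simpa [shiftCfg] using hB _ κ
    have hmν' : ∀ x κ, ‖shiftCfg (((L : ℤ) ^ j) • e ν) (shiftCfg (((L : ℤ) ^ j) • e lam) B) x κ
        - shiftCfg (((L : ℤ) ^ j) • e lam) B x κ‖ ≤ (L : ℝ) ^ j * g := fun x κ => by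
      have h := hmν (x + ((L : ℤ) ^ j) • e lam) κ
      simp only [shiftCfg_apply] at h ⊢
      rwa [add_right_comm x (((L : ℤ) ^ j) • e ν) (((L : ℤ) ^ j) • e lam)]
    have h := norm_logIter_shift_sub_le L hL (shiftCfg (((L : ℤ) ^ j) • e lam) B) j hb hkb hBLam
      (((L : ℤ) ^ j) • e ν) hmν' z μ
    have e10 : logIter L B j (z + e lam) μ = logIter L (shiftCfg (((L : ℤ) ^ j) • e lam) B) j z μ :=
      logIter_shiftCfg L B j (e lam) z μ
    have e11 : logIter L B j (z + e lam + e ν) μ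
        = logIter L (shiftCfg (((L : ℤ) ^ j) • e ν) (shiftCfg (((L : ℤ) ^ j) • e lam) B)) j z μ := by
      rw [add_right_comm z (e lam) (e ν), logIter_shiftCfg L B j (e lam) (z + e ν) μ,
        logIter_shiftCfg L (shiftCfg (((L : ℤ) ^ j) • e lam) B) j (e ν) z μ]
    rw [e11, e10]; exact h
  -- `Q(z+e_λ+e_ν) − Q(z+e_ν)`: a coarse `λ`-step at the translated field `t_{a_ν}B`
  have hDLam : ‖logIter L B j (z + e lam + e ν) μ - logIter L B j (z + e ν) μ‖
      ≤ 2 * d * (L : ℝ) ^ j * (1 + C3 d L * ((L : ℝ) ^ j * b)) * ((L : ℝ) ^ j * g) := by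
    have hBν : ∀ x κ, ‖shiftCfg (((L : ℤ) ^ j) • e ν) B x κ‖ ≤ b := fun x κ => by simpa [shiftCfg] using hB _ κ
    have hmLam' : ∀ x κ, ‖shiftCfg (((L : ℤ) ^ j) • e lam) (shiftCfg (((L : ℤ) ^ j) • e ν) B) x κ
        - shiftCfg (((L : ℤ) ^ j) • e ν) B x κ‖ ≤ (L : ℝ) ^ j * g := fun x κ => by
      have h := hmLam (x + ((L : ℤ) ^ j) • e ν) κ
      simp only [shiftCfg_apply] at h ⊢
      rwa [add_right_comm x (((L : ℤ) ^ j) • e lam) (((L : ℤ) ^ j) • e ν)]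
    have h := norm_logIter_shift_sub_le L hL (shiftCfg (((L : ℤ) ^ j) • e ν) B) j hb hkb hBν
      (((L : ℤ) ^ j) • e lam) hmLam' z μ
    have e01 : logIter L B j (z + e ν) μ = logIter L (shiftCfg (((L : ℤ) ^ j) • e ν) B) j z μ :=
      logIter_shiftCfg L B j (e ν) z μ
    have e11 : logIter L B j (z + e lam + e ν) μ
        = logIter L (shiftCfg (((L : ℤ) ^ j) • e lam) (shiftCfg (((L : ℤ) ^ j) • e ν) B)) j z μ := by
      rw [logIter_shiftCfg L B j (e ν) (z + e lam) μ, logIter_shiftCfg L (shiftCfg (((L : ℤ) ^ j) • e ν) B) j (e lam) z μ]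
    rw [e11, e01]; exact h
  have hQ11 : ‖logIter L B j (z + e lam + e ν) μ‖ ≤ 2 * ((L : ℝ) ^ j * b) := norm_logIter_le L hL B j hb hkb hB _ μ
  have hmain := norm_secondDiff_logIter_le L hL B j lam ν z μ hb hg hg₂ hr hk hroom hB hgLam hgν hG
  -- assemble with the product rule
  rw [eq418_split]
  set Q11 := logIter L B j (z + e lam + e ν) μ with hQ11def
  set Q10 := logIter L B j (z + e lam) μ with hQ10def
  set Q01 := logIter L B j (z + e ν) μ with hQ01def
  set Q00 := logIter L B j z μ with hQ00def
  set X := 2 * d * (L : ℝ) ^ j * (1 + C3 d L * ((L : ℝ) ^ j * b)) * ((L : ℝ) ^ j * g) with hX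
  set Mn := 2 * d * (L : ℝ) ^ j * (1 + C3 d L * ((L : ℝ) ^ j * b₁)) * ((L : ℝ) ^ j * g₂)
      + 2 * ((L : ℝ) ^ j * b₁) * ((L : ℝ) ^ j * g) * ((L : ℝ) ^ j * g) / r ^ 2 with hMn
  have hA : ‖ζ z • (Q11 - Q10 - Q01 + Q00)‖ ≤ Mn := by
    rw [norm_smul, Real.norm_eq_abs]
    exact (mul_le_mul hζ0 hmain (norm_nonneg _) zero_le_one).trans_eq (one_mul _)
  have hBterm : ‖(ζ (z + e lam) - ζ z) • (Q11 - Q10)‖ ≤ δ₁ * X := by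
    rw [norm_smul, Real.norm_eq_abs]
    exact mul_le_mul hζLam hDν (norm_nonneg _) ((abs_nonneg _).trans hζLam)
  have hCterm : ‖(ζ (z + e ν) - ζ z) • (Q11 - Q01)‖ ≤ δ₁ * X := by
    rw [norm_smul, Real.norm_eq_abs]
    exact mul_le_mul hζν hDLam (norm_nonneg _) ((abs_nonneg _).trans hζν)
  have hDterm : ‖(ζ (z + e lam + e ν) - ζ (z + e lam) - ζ (z + e ν) + ζ z) • Q11‖ ≤ δ₂ * (2 * ((L : ℝ) ^ j * b)) := by
    rw [norm_smul, Real.norm_eq_abs]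
    exact mul_le_mul hζ2 hQ11 (norm_nonneg _) ((abs_nonneg _).trans hζ2)
  calc ‖ζ z • (Q11 - Q10 - Q01 + Q00) + (ζ (z + e lam) - ζ z) • (Q11 - Q10) + (ζ (z + e ν) - ζ z) • (Q11 - Q01)
          + (ζ (z + e lam + e ν) - ζ (z + e lam) - ζ (z + e ν) + ζ z) • Q11‖
      ≤ Mn + δ₁ * X + δ₁ * X + δ₂ * (2 * ((L : ℝ) ^ j * b)) :=
        norm_add_le_of_le (norm_add_le_of_le (norm_add_le_of_le hA hBterm) hCterm) hDterm
    _ = Mn + 2 * (δ₁ * X) + δ₂ * (2 * ((L : ℝ) ^ j * b)) := by ring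

/-- **(4.18), the printed `(L^jη)^{2+β}` law** for `B = ηA`, with `θ` standing for `(L^jη)^β` (`L^jη ≤ θ ≤ 1`): if `sup ‖A‖ ≤ a`,
the fine `λ`-, `ν`-differences of `A` are `≤ ηa′` (one fine step is one `η`-step), the coarse variation of the fine `ν`-gradient
of `A` across `L^je_λ` is `≤ η·a″θ` (Hölder: `η|∇^ηA(y′) − ∇^ηA(y)| ≤ η‖A‖_{1,β}(L^jη)^β`), `|ζ̃| ≤ 1`, the coarse differences of
`ζ̃` are `≤ c₁L^jη` and its mixed second difference `≤ c₂(L^jη)²`, and the smallness `C₃(d,L)·L^jη·(2a + 4L^jηa′) ≤ 1` holds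
(polydisc radius `b₁ = 1/(C₃L^j)`, margin `r = b₁/4`), then
`‖(∂_λ∂_νB_μ)(z)‖ ≤ (4da″ + 32C₃(d,L)a′² + 8dc₁a′ + 2c₂a)·(L^jη)²·θ`. [cite: Balaban1987RG1, (4.18) p.285] -/
theorem ineq418_flat_scaled (ζ : B7Prop1Explicit.Site d → ℝ) (L : ℕ) (hL : 2 ≤ L) (A : B7Prop1Explicit.Site d → Fin d → 𝔸)
    (j : ℕ) (lam ν : Fin d) (z : B7Prop1Explicit.Site d) (μ : Fin d) {η a a' a'' θ c₁ c₂ : ℝ} (hη : 0 < η) (ha : 0 ≤ a)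
    (ha' : 0 ≤ a') (ha'' : 0 ≤ a'') (hθx : (L : ℝ) ^ j * η ≤ θ) (hθ1 : θ ≤ 1)
    (hsmall : C3 d L * ((L : ℝ) ^ j * η * (2 * a + 4 * ((L : ℝ) ^ j * η) * a')) ≤ 1)
    (hA : ∀ x κ, ‖A x κ‖ ≤ a) (hALam : ∀ x κ, ‖A (x + e lam) κ - A x κ‖ ≤ η * a')
    (hAν : ∀ x κ, ‖A (x + e ν) κ - A x κ‖ ≤ η * a')
    (hA2 : ∀ y κ, ‖(A (y + ((L : ℤ) ^ j) • e lam + e ν) κ - A (y + ((L : ℤ) ^ j) • e lam) κ) - (A (y + e ν) κ - A y κ)‖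
      ≤ η * (a'' * θ))
    (hζ0 : |ζ z| ≤ 1) (hζLam : |ζ (z + e lam) - ζ z| ≤ c₁ * ((L : ℝ) ^ j * η))
    (hζν : |ζ (z + e ν) - ζ z| ≤ c₁ * ((L : ℝ) ^ j * η))
    (hζ2 : |ζ (z + e lam + e ν) - ζ (z + e lam) - ζ (z + e ν) + ζ z| ≤ c₂ * ((L : ℝ) ^ j * η) ^ 2) :
    ‖ddlocB ζ L ((η : ℂ) • A) j lam ν z μ‖
      ≤ (4 * d * a'' + 32 * C3 d L * a' ^ 2 + 8 * d * c₁ * a' + 2 * c₂ * a) * ((L : ℝ) ^ j * η) ^ 2 * θ := by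
  have hL1 : 1 ≤ L := le_trans (by norm_num) hL
  set K : ℝ := (L : ℝ) ^ j with hK
  set c : ℝ := C3 d L with hc
  have hK0 : 0 < K := by rw [hK]; positivity
  have hc0 : 0 < c := by rw [hc]; exact C3_pos d L hL1
  set x : ℝ := K * η with hx
  have hx0 : 0 < x := mul_pos hK0 hη
  have hx1 : x ≤ 1 := hθx.trans hθ1
  have hθ0 : 0 ≤ θ := hx0.le.trans hθx
  -- the `B`-variable sizes of `B = ηA`
  have hηn : ‖(η : ℂ)‖ = η := by rw [Complex.norm_real, Real.norm_of_nonneg hη.le]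
  have hB : ∀ y κ, ‖((η : ℂ) • A) y κ‖ ≤ η * a := fun y κ => by
    rw [Pi.smul_apply, Pi.smul_apply, norm_smul, hηn]
    exact mul_le_mul_of_nonneg_left (hA y κ) hη.le
  have hgLam : ∀ y κ, ‖((η : ℂ) • A) (y + e lam) κ - ((η : ℂ) • A) y κ‖ ≤ η * (η * a') := fun y κ => by
    rw [Pi.smul_apply, Pi.smul_apply, Pi.smul_apply, Pi.smul_apply, ← smul_sub, norm_smul, hηn]
    exact mul_le_mul_of_nonneg_left (hALam y κ) hη.le
  have hgν : ∀ y κ, ‖((η : ℂ) • A) (y + e ν) κ - ((η : ℂ) • A) y κ‖ ≤ η * (η * a') := fun y κ => by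
    rw [Pi.smul_apply, Pi.smul_apply, Pi.smul_apply, Pi.smul_apply, ← smul_sub, norm_smul, hηn]
    exact mul_le_mul_of_nonneg_left (hAν y κ) hη.le
  have hG : ∀ y κ, ‖(((η : ℂ) • A) (y + ((L : ℤ) ^ j) • e lam + e ν) κ - ((η : ℂ) • A) (y + ((L : ℤ) ^ j) • e lam) κ)
      - (((η : ℂ) • A) (y + e ν) κ - ((η : ℂ) • A) y κ)‖ ≤ η * (η * (a'' * θ)) := fun y κ => by
    simp only [Pi.smul_apply]
    rw [← smul_sub, ← smul_sub, ← smul_sub, norm_smul, hηn]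
    exact mul_le_mul_of_nonneg_left (hA2 y κ) hη.le
  -- the radius `b₁ = 1/(C₃L^j)` and the margin `r = b₁/4`
  set b₁ : ℝ := 1 / (c * K) with hb₁
  have hb₁0 : 0 < b₁ := by rw [hb₁]; positivity
  have hcKb₁ : c * (K * b₁) = 1 := by rw [hb₁]; field_simp
  have hk : c * (K * b₁) ≤ 1 := hcKb₁.le
  have hS : η * a + 2 * (K * (η * (η * a'))) ≤ b₁ / 2 := by
    have h1 : (η * a + 2 * (K * (η * (η * a')))) * (2 * c * K) ≤ 1 := by
      have : c * (x * (2 * a + 4 * x * a')) = (η * a + 2 * (K * (η * (η * a')))) * (2 * c * K) := by rw [hx]; ring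
      rw [← this]; exact hsmall
    have h2 : η * a + 2 * (K * (η * (η * a'))) ≤ 1 / (2 * c * K) := (le_div_iff₀ (by positivity)).2 h1
    have h3 : 1 / (2 * c * K) = b₁ / 2 := by rw [hb₁]; field_simp
    rwa [h3] at h2
  have hroom : η * a + 2 * (K * (η * (η * a'))) + 2 * (b₁ / 4) ≤ b₁ := by linarith
  have hδ₁0 : 0 ≤ c₁ * x := (abs_nonneg _).trans hζLam
  have hδ₂0 : 0 ≤ c₂ * x ^ 2 := (abs_nonneg _).trans hζ2
  have h := ineq418_flat ζ L hL ((η : ℂ) • A) j lam ν z μ (b := η * a) (b₁ := b₁) (g := η * (η * a'))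
    (g₂ := η * (η * (a'' * θ))) (r := b₁ / 4) (δ₁ := c₁ * x) (δ₂ := c₂ * x ^ 2) (by positivity) (by positivity)
    (by positivity) (by positivity) hk hroom hB hgLam hgν hG hζ0 hζLam hζν hζ2
  rw [hcKb₁] at h
  -- term by term
  have hT1 : 2 * d * K * (1 + 1) * (K * (η * (η * (a'' * θ)))) = 4 * d * a'' * x ^ 2 * θ := by rw [hx]; ring
  have hT2 : 2 * (K * b₁) * (K * (η * (η * a'))) * (K * (η * (η * a'))) / (b₁ / 4) ^ 2 = 32 * c * a' ^ 2 * x ^ 4 := by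
    rw [hx, hb₁]; field_simp; ring
  have hxx : x ^ 2 ≤ x := by
    have := mul_le_mul_of_nonneg_left hx1 hx0.le
    simpa [sq] using this
  have hx2θ : x ^ 2 ≤ θ := hxx.trans hθx
  have hx4 : x ^ 4 ≤ x ^ 2 * θ :=
    calc x ^ 4 = x ^ 2 * x ^ 2 := by ring
      _ ≤ x ^ 2 * θ := mul_le_mul_of_nonneg_left hx2θ (sq_nonneg x)
  have hx3 : x ^ 3 ≤ x ^ 2 * θ :=
    calc x ^ 3 = x ^ 2 * x := by ring
      _ ≤ x ^ 2 * θ := mul_le_mul_of_nonneg_left hθx (sq_nonneg x)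
  have hT2le : 32 * c * a' ^ 2 * x ^ 4 ≤ 32 * c * a' ^ 2 * (x ^ 2 * θ) :=
    mul_le_mul_of_nonneg_left hx4 (by positivity)
  have hηa : c * (K * (η * a)) ≤ 1 := by
    have : η * a ≤ b₁ := by
      have h0 : 0 ≤ 2 * (K * (η * (η * a'))) := by positivity
      linarith
    calc c * (K * (η * a)) ≤ c * (K * b₁) := by gcongr
      _ = 1 := hcKb₁
  have hXle : 2 * d * K * (1 + c * (K * (η * a))) * (K * (η * (η * a'))) ≤ 4 * d * a' * x ^ 2 := by
    have h12 : 1 + c * (K * (η * a)) ≤ 2 := by linarith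
    calc 2 * d * K * (1 + c * (K * (η * a))) * (K * (η * (η * a')))
        ≤ 2 * d * K * 2 * (K * (η * (η * a'))) :=
          mul_le_mul_of_nonneg_right (mul_le_mul_of_nonneg_left h12 (by positivity)) (by positivity)
      _ = 4 * d * a' * x ^ 2 := by rw [hx]; ring
  have hT3le : 2 * (c₁ * x * (2 * d * K * (1 + c * (K * (η * a))) * (K * (η * (η * a')))))
      ≤ 8 * d * c₁ * a' * (x ^ 2 * θ) := by
    have h1 : c₁ * x * (2 * d * K * (1 + c * (K * (η * a))) * (K * (η * (η * a')))) ≤ c₁ * x * (4 * d * a' * x ^ 2) :=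
      mul_le_mul_of_nonneg_left hXle hδ₁0
    have hc₁ : 0 ≤ c₁ := nonneg_of_mul_nonneg_left hδ₁0 hx0
    have h2 : c₁ * x * (4 * d * a' * x ^ 2) = 4 * d * c₁ * a' * x ^ 3 := by ring
    have h3 : 4 * d * c₁ * a' * x ^ 3 ≤ 4 * d * c₁ * a' * (x ^ 2 * θ) := mul_le_mul_of_nonneg_left hx3 (by positivity)
    linarith
  have hT4le : c₂ * x ^ 2 * (2 * (K * (η * a))) ≤ 2 * c₂ * a * (x ^ 2 * θ) := by
    have hc₂ : 0 ≤ c₂ := nonneg_of_mul_nonneg_left hδ₂0 (by positivity)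
    have h1 : c₂ * x ^ 2 * (2 * (K * (η * a))) = 2 * c₂ * a * x ^ 3 := by rw [hx]; ring
    have h2 : 2 * c₂ * a * x ^ 3 ≤ 2 * c₂ * a * (x ^ 2 * θ) := mul_le_mul_of_nonneg_left hx3 (by positivity)
    linarith
  have htotal : (4 * d * a'' + 32 * c * a' ^ 2 + 8 * d * c₁ * a' + 2 * c₂ * a) * x ^ 2 * θ
      = 4 * d * a'' * x ^ 2 * θ + 32 * c * a' ^ 2 * (x ^ 2 * θ) + 8 * d * c₁ * a' * (x ^ 2 * θ)
        + 2 * c₂ * a * (x ^ 2 * θ) := by ring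
  rw [htotal]
  rw [hT1, hT2] at h
  linarith

/-- **(4.18), printed exponent form**: with `θ = (L^jη)^β`, `0 ≤ β ≤ 1` and `L^jη ≤ 1`, the bound of `ineq418_flat_scaled` reads
`‖(∂_λ∂_νB_μ)(z)‖ ≤ (4da″ + 32C₃a′² + 8dc₁a′ + 2c₂a)·(L^jη)^{2+β}` («|(∂_λ∂_νB_μ)(x)| < α₁(L^jη)^{2+β}, 0 ≦ β ≦ β₀ < 1»).
[cite: Balaban1987RG1, (4.18) p.285] -/
theorem ineq418_flat_rpow (ζ : B7Prop1Explicit.Site d → ℝ) (L : ℕ) (hL : 2 ≤ L) (A : B7Prop1Explicit.Site d → Fin d → 𝔸)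
    (j : ℕ) (lam ν : Fin d) (z : B7Prop1Explicit.Site d) (μ : Fin d) {η a a' a'' β c₁ c₂ : ℝ} (hη : 0 < η) (ha : 0 ≤ a)
    (ha' : 0 ≤ a') (ha'' : 0 ≤ a'') (hβ0 : 0 ≤ β) (hβ1 : β ≤ 1) (hx1 : (L : ℝ) ^ j * η ≤ 1)
    (hsmall : C3 d L * ((L : ℝ) ^ j * η * (2 * a + 4 * ((L : ℝ) ^ j * η) * a')) ≤ 1)
    (hA : ∀ x κ, ‖A x κ‖ ≤ a) (hALam : ∀ x κ, ‖A (x + e lam) κ - A x κ‖ ≤ η * a')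
    (hAν : ∀ x κ, ‖A (x + e ν) κ - A x κ‖ ≤ η * a')
    (hA2 : ∀ y κ, ‖(A (y + ((L : ℤ) ^ j) • e lam + e ν) κ - A (y + ((L : ℤ) ^ j) • e lam) κ) - (A (y + e ν) κ - A y κ)‖
      ≤ η * (a'' * ((L : ℝ) ^ j * η) ^ β))
    (hζ0 : |ζ z| ≤ 1) (hζLam : |ζ (z + e lam) - ζ z| ≤ c₁ * ((L : ℝ) ^ j * η))
    (hζν : |ζ (z + e ν) - ζ z| ≤ c₁ * ((L : ℝ) ^ j * η))
    (hζ2 : |ζ (z + e lam + e ν) - ζ (z + e lam) - ζ (z + e ν) + ζ z| ≤ c₂ * ((L : ℝ) ^ j * η) ^ 2) :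
    ‖ddlocB ζ L ((η : ℂ) • A) j lam ν z μ‖
      ≤ (4 * d * a'' + 32 * C3 d L * a' ^ 2 + 8 * d * c₁ * a' + 2 * c₂ * a) * ((L : ℝ) ^ j * η) ^ (2 + β) := by
  have hx0 : 0 < (L : ℝ) ^ j * η := by
    have hL0 : (0 : ℝ) < L := by exact_mod_cast (show 0 < L by omega)
    positivity
  have hθx : (L : ℝ) ^ j * η ≤ ((L : ℝ) ^ j * η) ^ β := by
    have h := Real.rpow_le_rpow_of_exponent_ge hx0 hx1 hβ1
    rwa [Real.rpow_one] at h
  have hθ1 : ((L : ℝ) ^ j * η) ^ β ≤ 1 := Real.rpow_le_one hx0.le hx1 hβ0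
  have h := ineq418_flat_scaled ζ L hL A j lam ν z μ hη ha ha' ha'' hθx hθ1 hsmall hA hALam hAν hA2 hζ0 hζLam hζν hζ2
  have hsplit : ((L : ℝ) ^ j * η) ^ (2 + β) = ((L : ℝ) ^ j * η) ^ 2 * ((L : ℝ) ^ j * η) ^ β := by
    rw [Real.rpow_add hx0, Real.rpow_two]
  rw [hsplit, ← mul_assoc]
  exact h

end Ineq418

end Literature.MathematicalPhysics.QuantumFieldTheory.Balaban1983to89.B12Ineq418Flat

end
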